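import Mathlib
import Summits.AnomalousDissipation.AnomalousDissipation.Theses.LimitingAbsorption
import Literature.Analysis.FluidPDE.PassiveScalarForced
import Literature.Analysis.FluidPDE.PassiveScalar

/-!
# Sketch (crux-ideate stmt-AnomalousDissipation-15010 `FloorUpgrade`, ideator k = 1, round 1)
# idea `bochner-zero-frequency-floor`

Signatures only (no proofs are claimed except the two trivial glue terms at the end).

Dictionary.  For a family `(ν_j, v_j)` and a profile `h` let `θrel s` be the homogeneous release
of `h` at phase `s` (weak solution of `∂_t θ + v_j(s+t)·∇θ = ν_j Δθ`, `θ(0) = h`) and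
`k(t,s) := ⟨h, θrel (min t s) |t-s|⟩` the LAG KERNEL; `C_j(τ) := LIM_t k(t, t-τ)` its long-time
mean (a generalized limit).  The absorbed power of the `h`-sourced cold start is
`P_j = LIM ⟨h, θ_j⟩ = ∫₀^∞ C_j(τ) dτ`.

* `ModulatedInputNonneg` / `LagKernelPosSemidef` : `k` is a positive semi-definite kernel
  (integrated form): `∫∫ a(t) a(s) k(t,s) = 2 × input of the a-modulated cold start ≥ 0`
  by the scalar ENERGY INEQUALITY.  Hence `C_j` is a positive-definite function, `C_j = μ̂_j`,
  `μ_j ≥ 0`, `μ_j(ℝ) = ‖h‖²` (sum rule) and `P_j = π ρ_j(0)` (zero-frequency spectral density).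
* `ZeroFrequencyFloor` (FIRST LEMMA, pure real analysis): positive-definite + exponentially
  decaying (analytic density) + quadratic structure bound at the origin (second spectral moment)
  ⇒ the zero-frequency density is bounded below as soon as the decay rate beats
  `κ₀ (A/M)^{1/3} Λ`.
* `RelaxingFamilyFast → UniformRelaxationWitness` : the conditional `FloorUpgrade` this yields
  (`γ² ‖h‖² ≥ 16 C^{1/3} G² E`, `G = sup ‖∇h‖`).
-/

set_option linter.dupNamespace false

noncomputable section

namespace Summit.AnomalousDissipation.AnomalousDissipation.Cruxes.FloorUpgrade.BochnerZeroFrequency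

open MeasureTheory Filter Topology Set
open scoped BigOperators ENNReal NNReal InnerProductSpace
open Summit.AnomalousDissipation.AnomalousDissipation.Theses.LimitingAbsorption

local notation "𝕋²" => UnitAddTorus (Fin 2)
local notation "E²" => EuclideanSpace ℝ (Fin 2)

/-- Positive-definite real function on `ℝ` (Bochner's sense, real symmetric form). -/
def IsPosDefFun (C : ℝ → ℝ) : Prop :=
  ∀ (n : ℕ) (τ : Fin n → ℝ) (c : Fin n → ℝ), 0 ≤ ∑ i, ∑ j, c i * c j * C (τ i - τ j)

/-- **FIRST LEMMA (abstract zero-frequency floor).**  There is a universal `κ₀ > 0` (the sketch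
proof gives the threshold `1.97`, so `κ₀ = 2` works) such that: for `0 < M ≤ A`, `γ, Λ > 0` with `γ ≥ κ₀ (A/M)^{1/3} Λ` there is
`ε = ε(M, A, γ, Λ) > 0` with `∫₀^∞ C ≥ ε` for EVERY continuous even positive-definite `C` with
`C(0) = M`, `|C(τ)| ≤ A e^{-γ|τ|}` and `M - C(τ) ≤ M Λ² τ²/2`.
Proof sketch: `C = μ̂`, `μ ≥ 0` of mass `M` with density `ρ` analytic in `|Im| < γ`,
`|ρ''| ≤ 27A/(2πγ³)` on `ℝ` (Cauchy), `∫ λ² dμ ≤ M Λ²` (Fatou on `(1 - cos λτ)/τ²`),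
`∫₀^∞ C = π ρ(0)`; if `ρ(0) = p` then `ρ(λ) ≤ p + (2ρ''_max p)^{1/2}|λ| + ρ''_max λ²/2`, and
`M ≤ M Λ²/L² + ∫_{|λ| ≤ L} ρ` for every `L`, which fails for small `p` once
`min_L (Λ²/L² + 1.43 (A/M) L³/γ³) < 1`, i.e. `γ > 1.97 (A/M)^{1/3} Λ`. -/
def ZeroFrequencyFloor : Prop :=
  ∃ κ₀ : ℝ, 0 < κ₀ ∧ ∀ (M A γ Λ : ℝ), 0 < M → M ≤ A → 0 < γ → 0 < Λ →
    κ₀ * (A / M) ^ ((1 : ℝ) / 3) * Λ ≤ γ →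
    ∃ ε : ℝ, 0 < ε ∧ ∀ C : ℝ → ℝ, Continuous C → (∀ τ, C (-τ) = C τ) → IsPosDefFun C →
      C 0 = M → (∀ τ, |C τ| ≤ A * Real.exp (-(γ * |τ|))) →
      (∀ τ, M - C τ ≤ M * Λ ^ 2 * τ ^ 2 / 2) →
      ε ≤ ∫ τ in Ioi (0 : ℝ), C τ

/-- **PD-ness, PDE form 1 (modulated input is nonnegative).**  For `κ > 0`, a locally bounded
drift, a smooth profile `h` and a continuous amplitude `a`, every weak solution of
`∂_t θ + u·∇θ = κΔθ + a(t) h`, `θ(0) = 0` on `[0,T)` has `∫₀ᵀ a(t) ⟨h, θ(t)⟩ dt ≥ 0`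
(energy inequality: `= ½‖θ(T⁻)‖² + κ ∫‖∇θ‖² ≥ 0`, the RIGHT direction of the inequality). -/
def ModulatedInputNonneg : Prop :=
  ∀ (κ T : ℝ) (u : ℝ → 𝕋² → E²) (h : 𝕋² → ℝ) (a : ℝ → ℝ) (θ : ℝ → 𝕋² → ℝ),
    0 < κ → 0 < T → Continuous a → Literature.Analysis.FunctionSpaces.Torus.IsSmooth h →
    MemLp (Literature.Analysis.FunctionSpaces.Torus.stLift u) ⊤
      (volume.restrict (Ioo (0 : ℝ) T ×ˢ univ)) →
    Literature.Analysis.FluidPDE.Torus.IsWeakScalarTransportForcedOn T κ u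
      (fun t x => a t * h x) 0 θ →
    0 ≤ ∫ t in Ioo (0 : ℝ) T, a t * ∫ x, h x * θ t x

/-- The symmetric LAG KERNEL `k(t,s) = ⟨h, θrel (min t s) |t - s|⟩` of a two-parameter family of
homogeneous releases `θrel s` (release of `h` at phase `s`, in elapsed time). -/
def lagKernel (h : 𝕋² → ℝ) (θrel : ℝ → ℝ → 𝕋² → ℝ) (t s : ℝ) : ℝ :=
  ∫ x, h x * θrel (min t s) |t - s| x

/-- **PD-ness, PDE form 2 (Gram structure of the lag kernel, integrated).**  If `θrel s` is, for
every phase `s ≥ 0`, a weak solution of the homogeneous problem with drift `u(s + ·)` and datum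
`h`, then `∫₀ᵀ∫₀ᵀ a(t) a(s) k(t,s) ds dt ≥ 0` for every continuous `a` — by superposition
(`θ^a(t) = ∫₀ᵗ a(s) θrel s (t-s) ds` is the `a`-modulated cold start; bounded-drift uniqueness,
tree toolkit `forced_ae_eq_of_memLp_top`) and `ModulatedInputNonneg`.  Consequence: every
generalized long-time mean `C(τ) = LIM_t k(t,t-τ)` is a positive-definite function
(`IsPosDefFun`), `C(0) = ‖h‖²`. -/
def LagKernelPosSemidef : Prop :=
  ∀ (κ : ℝ) (u : ℝ → 𝕋² → E²) (h : 𝕋² → ℝ) (θrel : ℝ → ℝ → 𝕋² → ℝ), 0 < κ →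
    Literature.Analysis.FunctionSpaces.Torus.IsSmooth h →
    (∀ T : ℝ, 0 < T → MemLp (Literature.Analysis.FunctionSpaces.Torus.stLift u) ⊤
      (volume.restrict (Ioo (0 : ℝ) T ×ˢ univ))) →
    (∀ s : ℝ, 0 ≤ s → ∀ T : ℝ, 0 < T →
      Literature.Analysis.FluidPDE.Torus.IsWeakScalarTransportOn T κ (fun t => u (s + t)) h
        (θrel s)) →
    ∀ (T : ℝ) (a : ℝ → ℝ), 0 < T → Continuous a →
      0 ≤ ∫ t in Ioo (0 : ℝ) T, ∫ s in Ioo (0 : ℝ) T, a t * a s * lagKernel h θrel t s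

/-- **Ballistic structure bound with a sliding-window energy only** (deterministic; test the
release against `h`, use `⟨h, u·∇h⟩ = 0` and `‖θrel r (τ)‖ ≤ ‖h‖`):
`‖h‖² - k(t, r) ≤ 2κ(t-r)‖h‖‖Δh‖ + 2 (∫_r^t ‖u(τ)·∇h‖_{L²} dτ)²` for `0 ≤ r ≤ t`.  Averaged in
`t` it gives `‖h‖² - C(τ) ≤ ½ τ² · LIM-avg ‖u·∇h‖² + O(κτ)`, i.e. the second spectral moment of
the limit measure is at most `‖∇h‖_∞² E`. -/
def BallisticStructureBound : Prop :=
  ∀ (κ : ℝ) (u : ℝ → 𝕋² → E²) (h : 𝕋² → ℝ) (θrel : ℝ → ℝ → 𝕋² → ℝ) (Dh : ℝ), 0 < κ →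
    Literature.Analysis.FunctionSpaces.Torus.IsSmooth h →
    Literature.Analysis.FluidPDE.Torus.scalarL2Sq
        (Literature.Analysis.FunctionSpaces.Torus.laplacian h) ≤ Dh ^ 2 →
    (∀ T : ℝ, 0 < T → MemLp (Literature.Analysis.FunctionSpaces.Torus.stLift u) ⊤
      (volume.restrict (Ioo (0 : ℝ) T ×ˢ univ))) →
    (∀ s : ℝ, 0 ≤ s → ∀ T : ℝ, 0 < T →
      Literature.Analysis.FluidPDE.Torus.IsWeakScalarTransportOn T κ (fun t => u (s + t)) h
        (θrel s)) →
    ∀ (r t : ℝ), 0 ≤ r → r ≤ t → ∀ᵐ t' ∂(volume.restrict (Ioo r t)),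
      Literature.Analysis.FluidPDE.Torus.scalarL2Sq h - lagKernel h θrel t' r ≤
        2 * κ * (t' - r) * Real.sqrt (Literature.Analysis.FluidPDE.Torus.scalarL2Sq h) * Dh +
        2 * (∫ τ in Ioo r t', Real.sqrt (∫ x,
              (⟪u τ x, Literature.Analysis.FunctionSpaces.Torus.gradient h x⟫_ℝ) ^ 2)) ^ 2

/-- `RelaxingFamily` sharpened by the FAST-RELAXER condition `γ² ‖h‖² ≥ 16 C^{1/3} G² E`
(`G = sup |∇h|`), i.e. `γ ≥ 4 C^{1/6} Λ₀`, `Λ₀ := G (E/‖h‖²)^{1/2}` the mean sweeping frequency. -/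
def RelaxingFamilyFast : Prop :=
  ∃ (g : 𝕋² → E²) (h : 𝕋² → ℝ), Literature.Analysis.FunctionSpaces.Torus.IsSmooth g ∧
    Literature.Analysis.FunctionSpaces.Torus.IsDivFree g ∧
    Literature.Analysis.FunctionSpaces.Torus.HasZeroMean g ∧
    Literature.Analysis.FunctionSpaces.Torus.IsSmooth h ∧
    Literature.Analysis.FunctionSpaces.Torus.HasZeroMean h ∧ h ≠ 0 ∧
    ∃ (ν : ℕ → ℝ) (v₀ : ℕ → 𝕋² → E²) (v : ℕ → ℝ → 𝕋² → E²), (∀ j, 0 < ν j) ∧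
      Filter.Tendsto ν Filter.atTop (nhds 0) ∧
      (∀ j, Literature.Analysis.FluidPDE.Torus.IsGlobalLerayHopf (ν j) (fun _ => g) (v₀ j) (v j)) ∧
      (∀ j : ℕ, ∀ (T : ℝ), 0 < T → MeasureTheory.MemLp
        (Literature.Analysis.FunctionSpaces.Torus.stLift (v j)) ⊤
        (MeasureTheory.volume.restrict (Set.Ioo (0 : ℝ) T ×ˢ Set.univ))) ∧
      ∃ E C γ G : ℝ, (∀ j, Literature.Analysis.FluidPDE.meanEnergy (v j) ≤ E) ∧ 0 ≤ C ∧ 0 < γ ∧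
        (∀ x, ‖Literature.Analysis.FunctionSpaces.Torus.gradient h x‖ ≤ G) ∧
        16 * C ^ ((1 : ℝ) / 3) * G ^ 2 * E ≤
          γ ^ 2 * Literature.Analysis.FluidPDE.Torus.scalarL2Sq h ∧
        ∀ (j : ℕ) (s : ℝ), 0 ≤ s → ∀ (T : ℝ) (θ : ℝ → 𝕋² → ℝ),
          Literature.Analysis.FluidPDE.Torus.IsWeakScalarTransportOn T (ν j)
            (fun t => v j (s + t)) h θ →
          ∀ᵐ t ∂(MeasureTheory.volume.restrict (Set.Ioo (0 : ℝ) T)),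
            Literature.Analysis.FluidPDE.Torus.scalarL2Sq (θ t) ≤
              C * Real.exp (-(γ * t)) * Literature.Analysis.FluidPDE.Torus.scalarL2Sq h

/-- **The conditional `FloorUpgrade` the lever delivers** (line target): fast relaxers have the
absorbed-power floor, for the SAME `(g, h, ν, v₀, v)` and the SAME `(C, γ)`. -/
def FastFloorUpgrade : Prop := RelaxingFamilyFast → UniformRelaxationWitness

/-- Sanity: the fast class is a subclass of the crux's hypothesis. -/
theorem relaxingFamily_of_fast : RelaxingFamilyFast → RelaxingFamily := by
  rintro ⟨g, h, hg, hgd, hgm, hh, hhm, hne, ν, v₀, v, hν, hνlim, hLH, hbd, E, C, γ, G, hE, hC, hγ,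
    _hG, _hfast, hrel⟩
  exact ⟨g, h, hg, hgd, hgm, hh, hhm, hne, ν, v₀, v, hν, hνlim, hLH, hbd, ⟨E, hE⟩, C, γ, hC, hγ,
    hrel⟩

/-- Shape of the line: `FloorUpgrade` from the fast-relaxer floor plus the honest residual
("a relaxing family may be taken fast"). -/
theorem floorUpgrade_of_fast (boost : RelaxingFamily → RelaxingFamilyFast)
    (fast : FastFloorUpgrade) : FloorUpgrade :=
  fun hR => fast (boost hR)

end Summit.AnomalousDissipation.AnomalousDissipation.Cruxes.FloorUpgrade.BochnerZeroFrequency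

end
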